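import Mathlib
import Summits.NavierStokesRegularity.NavierStokesRegularity.Theorems.ScenarioCensusPeriodicSlabWindow
import HarnessLib

/-!
# Census row S7 (bounded steady flows in the periodic slab, case (d)): volume of one period of
# a cylinder, pointwise derivative bounds, and the algebra of the dyadic estimate

Support file for the scenario census of `NavierStokesRegularity` (cell `pub/ns-census`, row S7 =
Bang–Gui–Wang–Xie 2025, Thm 1.4 (d); tree FACT
`Literature.Analysis.FluidPDE.BangGuiWangXie2025_periodicSlab_liouville`, second conjunct). Small
inputs of the dyadic energy estimate (`…PeriodicSlabEstimate`), kept in their own file: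

* `volume_zSlab_inter_cyl_le` — one period of the cylinder `{ρ < R}` has volume `≤ 8 L R²`
  (it lies in a box; this is the `|𝒪_R| ≲ R` bookkeeping of the printed proof, arXiv:2205.13259
  §5, in the crude form sufficient for the dyadic argument);
* `partial_bounds` — `‖∂₃U‖ ≤ ‖DU‖`, `‖D ∂₃U‖ ≤ ‖D²U‖`, `|D ∂₃U|² ≤ 3 ‖D²U‖²` (Frobenius);
* `alg_*` — the field identities used to collect the term bounds (proved once, outside the long
  estimate, so that `field_simp` runs in an empty context).

No summit statement and no census row is proved in this file.

## References

* J. Bang, C. Gui, Y. Wang, C. Xie, J. Fluid Mech. 1005 (2025) A6 = arXiv:2205.13259, §5 Step 4.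
  [BangGuiWangXie2025]
-/

-- the summit and its single problem share the name (D-0017 nested layout)
set_option linter.dupNamespace false

noncomputable section

open MeasureTheory Set Function Filter InnerProductSpace
open scoped Topology ENNReal NNReal RealInnerProductSpace ContDiff

namespace Summit.NavierStokesRegularity.NavierStokesRegularity.Theorems.ScenarioCensus.PeriodicSlab

open Literature.Analysis Literature.Analysis.FluidPDE

/-! ### Volume of one period of a cylinder -/

/-- A coordinate is bounded by the horizontal radius: `|x₀| ≤ ρ(x)`, `|x₁| ≤ ρ(x)`. -/
theorem abs_apply_le_cylRadius (x : EuclideanSpace ℝ (Fin 3)) :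
    |x 0| ≤ cylRadius x ∧ |x 1| ≤ cylRadius x :=
  ⟨Real.abs_le_sqrt (by nlinarith [sq_nonneg (x 1)]), Real.abs_le_sqrt (by nlinarith [sq_nonneg (x 0)])⟩

/-- **One period of the cylinder `{ρ < R}` has volume at most `8 L R²`** (it lies in the box
`(−R, R)² × (−L, L)`; `L, R > 0`). -/
theorem volume_zSlab_inter_cyl_le {L R : ℝ} (hL : 0 < L) (hR : 0 < R) :
    volume (zSlab L 0 ∩ {x | cylRadius x < R}) ≤ ENNReal.ofReal (8 * L * R ^ 2) := by
  set lo : Fin 3 → ℝ := ![-R, -R, -L] with hlo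
  set hi : Fin 3 → ℝ := ![R, R, L] with hhi
  have hsub : zSlab L 0 ∩ {x | cylRadius x < R} ⊆
      (fun x : EuclideanSpace ℝ (Fin 3) => (WithLp.ofLp x : Fin 3 → ℝ)) ⁻¹'
        Set.pi univ (fun i => Ioo (lo i) (hi i)) := by
    rintro x ⟨hxS, hxR⟩
    rw [mem_zSlab] at hxS
    simp only [Int.cast_zero, zero_mul, zero_add, one_mul] at hxS
    have hxR' : cylRadius x < R := hxR
    obtain ⟨h0, h1⟩ := abs_apply_le_cylRadius x
    rw [mem_preimage, mem_univ_pi]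
    intro i
    fin_cases i
    · have := abs_lt.1 (lt_of_le_of_lt h0 hxR')
      simpa [hlo, hhi] using this
    · have := abs_lt.1 (lt_of_le_of_lt h1 hxR')
      simpa [hlo, hhi] using this
    · simp only [hlo, hhi]
      exact ⟨by simp; linarith [hxS.1], by simpa using hxS.2⟩
  calc volume (zSlab L 0 ∩ {x | cylRadius x < R})
      ≤ volume ((fun x : EuclideanSpace ℝ (Fin 3) => (WithLp.ofLp x : Fin 3 → ℝ)) ⁻¹'
          Set.pi univ (fun i => Ioo (lo i) (hi i))) := measure_mono hsub
    _ = volume (Set.pi univ (fun i => Ioo (lo i) (hi i))) :=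
        (PiLp.volume_preserving_ofLp (Fin 3)).measure_preimage
          (MeasurableSet.univ_pi fun i => measurableSet_Ioo).nullMeasurableSet
    _ = ∏ i, ENNReal.ofReal (hi i - lo i) := Real.volume_pi_Ioo
    _ = ENNReal.ofReal (8 * L * R ^ 2) := by
        rw [Fin.prod_univ_three]
        simp only [hlo, hhi, Matrix.cons_val_zero, Matrix.cons_val_one, Matrix.cons_val_two,
          Matrix.head_cons, Matrix.tail_cons, sub_neg_eq_add]
        rw [← ENNReal.ofReal_mul (by linarith), ← ENNReal.ofReal_mul (by positivity)]
        congr 1; ring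

/-- The Frobenius energy density of a `C¹` field is integrable on one period of any cylinder if
it is bounded. -/
theorem integrableOn_zSlab_inter_cyl_of_bound {L R : ℝ} (hL : 0 < L) (hR : 0 < R)
    {F : EuclideanSpace ℝ (Fin 3) → ℝ} (hFc : Continuous F) {B : ℝ} (hFB : ∀ x, ‖F x‖ ≤ B) :
    IntegrableOn F (zSlab L 0 ∩ {x | cylRadius x < R}) volume := by
  have hfin : volume (zSlab L 0 ∩ {x | cylRadius x < R}) ≠ ⊤ :=
    (lt_of_le_of_lt (volume_zSlab_inter_cyl_le hL hR) ENNReal.ofReal_lt_top).ne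
  exact Measure.integrableOn_of_bounded hfin hFc.aestronglyMeasurable (Eventually.of_forall hFB)

/-! ### Pointwise bounds for `w = ∂₃U` -/

/-- **Pointwise bounds for the axial derivative.** For `U ∈ C²` with `‖D²U‖ ≤ K₂`:
`‖D(∂₃U)(x)‖ ≤ K₂`, `|D(∂₃U)(x)|² ≤ 3 K₂²` (Frobenius norm), and `‖∂₃U(x)‖ ≤ ‖DU(x)‖`. -/
theorem partial_bounds {U : EuclideanSpace ℝ (Fin 3) → EuclideanSpace ℝ (Fin 3)}
    (hU2 : ContDiff ℝ 2 U) {K₂ : ℝ} (hK₂ : ∀ x, ‖iteratedFDeriv ℝ 2 U x‖ ≤ K₂)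
    (x : EuclideanSpace ℝ (Fin 3)) :
    ‖fderiv ℝ (fun y => fderiv ℝ U y eZ) x‖ ≤ K₂ ∧
      frobeniusNormSq (fderiv ℝ (fun y => fderiv ℝ U y eZ) x) ≤ 3 * K₂ ^ 2 ∧
      ‖fderiv ℝ U x eZ‖ ≤ ‖fderiv ℝ U x‖ := by
  set b := EuclideanSpace.basisFun (Fin 3) ℝ with hb
  have heZ : ‖(eZ : EuclideanSpace ℝ (Fin 3))‖ = 1 := by simp [eZ]
  have hDU2 : ‖fderiv ℝ (fderiv ℝ U) x‖ ≤ K₂ := by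
    rw [← norm_iteratedFDeriv_zero (𝕜 := ℝ) (f := fderiv ℝ (fderiv ℝ U)), norm_iteratedFDeriv_fderiv,
      norm_iteratedFDeriv_fderiv]
    exact hK₂ x
  have hDUd : DifferentiableAt ℝ (fderiv ℝ U) x :=
    ((hU2.fderiv_right (m := 1) le_rfl).differentiable one_ne_zero) x
  have hDw_op : ‖fderiv ℝ (fun y => fderiv ℝ U y eZ) x‖ ≤ K₂ := by
    refine ContinuousLinearMap.opNorm_le_bound _
      ((norm_nonneg (fderiv ℝ (fderiv ℝ U) x)).trans hDU2) fun v => ?_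
    rw [fderiv_apply_const_apply hDUd eZ v]
    calc ‖fderiv ℝ (fderiv ℝ U) x v eZ‖
        ≤ ‖fderiv ℝ (fderiv ℝ U) x v‖ * ‖(eZ : EuclideanSpace ℝ (Fin 3))‖ :=
          ContinuousLinearMap.le_opNorm _ _
      _ ≤ ‖fderiv ℝ (fderiv ℝ U) x‖ * ‖v‖ * 1 := by
          rw [heZ]; exact mul_le_mul_of_nonneg_right (ContinuousLinearMap.le_opNorm _ _) zero_le_one
      _ ≤ K₂ * ‖v‖ := by rw [mul_one]; exact mul_le_mul_of_nonneg_right hDU2 (norm_nonneg _)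
  refine ⟨hDw_op, ?_, ?_⟩
  · rw [frobeniusNormSq_eq_sum b]
    calc ∑ i, ‖fderiv ℝ (fun y => fderiv ℝ U y eZ) x (b i)‖ ^ 2 ≤ ∑ _i : Fin 3, K₂ ^ 2 :=
          Finset.sum_le_sum fun i _ => by
            have h1 : ‖fderiv ℝ (fun y => fderiv ℝ U y eZ) x (b i)‖ ≤ K₂ := by
              calc ‖fderiv ℝ (fun y => fderiv ℝ U y eZ) x (b i)‖
                  ≤ ‖fderiv ℝ (fun y => fderiv ℝ U y eZ) x‖ * ‖b i‖ := ContinuousLinearMap.le_opNorm _ _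
                _ ≤ K₂ := by rw [b.orthonormal.1 i, mul_one]; exact hDw_op
            exact pow_le_pow_left₀ (norm_nonneg _) h1 2
      _ = 3 * K₂ ^ 2 := by simp
  · calc ‖fderiv ℝ U x eZ‖ ≤ ‖fderiv ℝ U x‖ * ‖(eZ : EuclideanSpace ℝ (Fin 3))‖ :=
          ContinuousLinearMap.le_opNorm _ _
      _ = ‖fderiv ℝ U x‖ := by rw [heZ, mul_one]

/-! ### Elementary algebra used in the estimate (kept outside the long proof) -/

/-- `(t a − b)²/t = t a² + b²/t − 2 b a` for `t ≠ 0`. -/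
theorem alg_sq_div (t a b : ℝ) (ht : t ≠ 0) :
    (t * a - b) ^ 2 / t = t * a ^ 2 + b ^ 2 / t - 2 * (b * a) := by
  field_simp
  ring

/-- With `t = 2π/L` and `κ = (L/(2π))²`: `(M t/2) κ I + (M/(2t)) I = (M L/(2π)) I` (`L ≠ 0`). -/
theorem alg_absorb (M L I : ℝ) (hL : L ≠ 0) :
    M * (2 * Real.pi / L) / 2 * ((L / (2 * Real.pi)) ^ 2 * I) + M / (2 * (2 * Real.pi / L)) * I =
      M * L / (2 * Real.pi) * I := by
  have hπ : Real.pi ≠ 0 := Real.pi_ne_zero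
  field_simp
  ring

/-- `C K² λ/(2r) · (32 L r²) = 16 C K² L λ r` (`r ≠ 0`). -/
theorem alg_volume (C K lam L r : ℝ) (hr : r ≠ 0) :
    C * K ^ 2 * lam / (2 * r) * (32 * L * r ^ 2) = 16 * C * K ^ 2 * L * lam * r := by
  field_simp
  ring

/-- `C/r · χ · ((λ K² + w²/λ)/2) = C K² λ/(2r) χ + C/(2 λ r) (χ w²)` (`r, λ ≠ 0`). -/
theorem alg_split (C r χ lam K w : ℝ) (hr : r ≠ 0) (hlam : lam ≠ 0) :
    C / r * χ * ((lam * K ^ 2 + w ^ 2 / lam) / 2) =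
      C * K ^ 2 * lam / (2 * r) * χ + C / (2 * lam * r) * (χ * w ^ 2) := by
  field_simp

/-- The bookkeeping identity collecting the five term bounds of the dyadic estimate. -/
theorem alg_collect (ν C₀ M κ D r lam : ℝ) (hr : r ≠ 0) (hlam : lam ≠ 0) :
    C₀ * (3 * ν * (1 + κ) / 2 + 3 * M * κ / 2) * D / r + C₀ * κ / 2 * D / (lam * r) =
      ν * (3 * (C₀ / (2 * r) * (D + κ * D))) + 2⁻¹ * (C₀ * M / r * (κ * D)) +
        C₀ * M / r * (κ * D) + C₀ / (2 * lam * r) * (κ * D) := by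
  field_simp
  ring

end Summit.NavierStokesRegularity.NavierStokesRegularity.Theorems.ScenarioCensus.PeriodicSlab

end
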